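import Summits.Ventures.LatticeQCDFlow.Exactness.Phi4HMCTailEnergy
import Summits.Ventures.LatticeQCDFlow.Exactness.HMCMomentumMoments
import HarnessLib

/-!
# The leapfrog overshoots the quartic wall, II: from the far box one-step HMC is rejected

HONEST FRAMING: exact (Metropolis-corrected) sampling algorithms for lattice gauge theory;
figures of merit are autocorrelation/cost numbers at stated couplings and volumes; no
continuum-physics claim.  (SCALAR calibration rung S0-A: not a gauge result.)

Venture `LatticeQCDFlow` (cell pub-lqcd), topic `Exactness`; FANOUT row 2 (`s0-phi4`, HMC arm).
NEW WORK of the cell over `Exactness/Phi4HMCTailEnergy.lean` (the energy gap of the one-step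
proposal from the box `A_t`) and `Exactness/HMCMomentumMoments.lean` (`⟨p_x²⟩ = 1` under the
refresh law).  Nothing is cited as a fact.
The phenomenon — for potentials
growing faster than quadratically the leapfrog map with a FIXED step size is unstable far out, the
proposal lands at an energy far above the starting one and is rejected, so that HMC is not
geometrically ergodic for such targets — is printed for HMC on `ℝ^d` (Livingstone, Betancourt, Byrne,
Girolami, Bernoulli 25 (2019) §5; Roberts–Tweedie 1996 for the rejection-probability criterion;
Bou-Rabee–Sanz-Serna, Acta Numerica 2018, on leapfrog stability), NAMED ONLY; here it is a
quantitative lemma about row 2's lattice φ⁴ HMC with ONE qpq leapfrog step per trajectory (the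
"Langevin corner" of `Phi4HMCOneStepCSD`), every `λ > 0`, every real `J`, every step size `δ > 0`.

## What is proved (`Λ = Fin (n+1)`, `V = n+1`, `C_J = Σ_{x,y} |J_{xy}|`, `A_t = {t ≤ φ_x ≤ 2t ∀x}`,
`a(φ,p) = min(1, e^{H(φ,p) − H(Ψ(φ,p))})`, `Z_p = ∫ e^{−½Σp²}`)

* **`involAccept_le_of_mem_box`** — once the energy gap from `A_t` is `≥ L`, for EVERY momentum
  `a(φ, p) ≤ e^{−L} + (δ/t)² Σ_x p_x²` (Chebyshev's indicator bound prices the momenta beyond `t/δ`);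
* `integrable_involAccept_mul_momentumWeight`, `integral_sq_mul_momentumWeight`,
  `integrable_sq_mul_momentumWeight`, **`accept_le_of_mem_box`** —
  `Z_p⁻¹ ∫ a(φ, p) e^{−½Σp²} dp ≤ e^{−L} + V(δ/t)²`;
* `poly_gap_ge`, `kick_threshold`, `gap_threshold`, `cheb_threshold`, `exp_neg_threshold` — every
  threshold is met for `t` beyond an explicit constant;
* **`hmcPhi4_oneStep_accept_le_of_mem_box`** — every `λ > 0`, real `J`, `δ > 0`: for every
  `ε > 0` and `T₀` there is `t ≥ max(T₀, 1)` such that from EVERY configuration of the box `A_t` the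
  one-step HMC update (refresh, one qpq leapfrog step of size `δ`, flip, Metropolis test) is
  accepted with probability at most `ε`;
* `box_eq_Icc`, `measurableSet_box`, `boxInd_bddObs`, **`integral_boxInd_pos`**, `integral_boxInd_le`
  — the box is the order interval `[t·𝟙, 2t·𝟙]`, its indicator `χ_t` is a bounded measurable
  observable, `∫ χ_t e^{−S} > 0` (`t > 0`), and `∫ χ_t e^{−S} ≤ t⁻² ∫ φ₀² e^{−S}` (Chebyshev).

Reading (no numerics implied): at fixed `δ` the exact one-step HMC has a box of configurations of
positive Gibbs mass from which essentially every trajectory is rejected;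
`Exactness/Phi4HMCNoSpectralGap.lean` turns this into the absence of an `L²(e^{−S})` spectral gap.
NOT CLAIMED: the size of `π(A_t)` (astronomically small at simulated parameters — a statement about
the tails of the chain, not about `τ_int(M)`); `N ≥ 2` leapfrog steps; adaptive / randomised steps.
-/

namespace Summit.Ventures.LatticeQCDFlow.Exactness

open Real MeasureTheory Filter Finset
open Summit.Ventures.LatticeQCDFlow.Scoring

section TailRejection

variable {n : ℕ}

/-! ## §3 The acceptance probability from the far box -/

/-- **Pointwise acceptance bound.**  Under the hypotheses of `hmc_energy_gap_of_mem_box` with the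
gap `≥ L`, for EVERY momentum `p` (not only `|p_y| ≤ t/δ`):
`a(φ, p) ≤ e^{−L} + (δ/t)² Σ_x p_x²` (`t > 0`; Chebyshev's indicator bound for the far momenta). -/
theorem involAccept_le_of_mem_box {lam δ t L : ℝ} (hlam : 0 < lam) (hδ : 0 < δ) (ht : 0 < t)
    (J : Fin (n + 1) → Fin (n + 1) → ℝ) {φ : Fin (n + 1) → ℝ}
    (hφ : ∀ y, t ≤ φ y ∧ φ y ≤ 2 * t)
    (hbig : t / δ + 5 * δ * t * (∑ x, ∑ y, |J x y|) ≤ δ * lam * t ^ 3 / 4)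
    (hgap : L ≤ ((n : ℝ) + 1) * (δ * lam * t ^ 3 / 4) ^ 2 / 2
        - ((n : ℝ) + 1) * (((∑ x, ∑ y, |J x y|) + 1) ^ 2 / (4 * lam))
        - 4 * t ^ 2 * (∑ x, ∑ y, |J x y|) - 16 * lam * ((n : ℝ) + 1) * t ^ 4
        - ((n : ℝ) + 1) * (t / δ) ^ 2 / 2) (p : Fin (n + 1) → ℝ) :
    involAccept (phi4HmcEnergy J lam) (hmcProposal J lam δ 1) (φ, p)
      ≤ Real.exp (-L) + (δ / t) ^ 2 * ∑ x, p x ^ 2 := by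
  have hsum0 : 0 ≤ (δ / t) ^ 2 * ∑ x, p x ^ 2 :=
    mul_nonneg (sq_nonneg _) (Finset.sum_nonneg fun x _ => sq_nonneg _)
  by_cases hG : ∀ y, |p y| ≤ t / δ
  · -- good momenta: the energy gap forces rejection
    have hΔ := hmc_energy_gap_of_mem_box hlam hδ ht.le J hφ hG hbig
    unfold involAccept
    calc min 1 (Real.exp (phi4HmcEnergy J lam (φ, p)
          - phi4HmcEnergy J lam (hmcProposal J lam δ 1 (φ, p))))
        ≤ Real.exp (phi4HmcEnergy J lam (φ, p)
          - phi4HmcEnergy J lam (hmcProposal J lam δ 1 (φ, p))) := min_le_right _ _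
      _ ≤ Real.exp (-L) := Real.exp_le_exp.mpr (by linarith)
      _ ≤ Real.exp (-L) + (δ / t) ^ 2 * ∑ x, p x ^ 2 := le_add_of_nonneg_right hsum0
  · -- a far momentum: Chebyshev's indicator bound `1 ≤ (δ/t)² p_y²`
    push Not at hG
    obtain ⟨y, hy⟩ := hG
    have h1 : (1 : ℝ) ≤ (δ / t) ^ 2 * ∑ x, p x ^ 2 := by
      have hy2 : (t / δ) ^ 2 < p y ^ 2 := by
        rw [← sq_abs (p y)]
        exact pow_lt_pow_left₀ hy (by positivity) two_ne_zero
      have hle : p y ^ 2 ≤ ∑ x, p x ^ 2 :=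
        Finset.single_le_sum (f := fun x => p x ^ 2) (fun x _ => sq_nonneg _) (Finset.mem_univ y)
      have e : (δ / t) ^ 2 * (t / δ) ^ 2 = 1 := by field_simp
      have hδt : 0 < (δ / t) ^ 2 := by positivity
      nlinarith
    calc involAccept (phi4HmcEnergy J lam) (hmcProposal J lam δ 1) (φ, p) ≤ 1 := involAccept_le_one _ _ _
      _ ≤ (δ / t) ^ 2 * ∑ x, p x ^ 2 := h1
      _ ≤ Real.exp (-L) + (δ / t) ^ 2 * ∑ x, p x ^ 2 := le_add_of_nonneg_left (Real.exp_pos _).le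

/-- The acceptance integrand `p ↦ a(φ, p) e^{−½Σp²}` is integrable (bounded by the Gaussian weight). -/
theorem integrable_involAccept_mul_momentumWeight (J : Fin (n + 1) → Fin (n + 1) → ℝ) (lam δ : ℝ)
    (N : ℕ) (φ : Fin (n + 1) → ℝ) :
    Integrable (fun p : Fin (n + 1) → ℝ =>
      involAccept (phi4HmcEnergy J lam) (hmcProposal J lam δ N) (φ, p) * momentumWeight p) := by
  have hH := measurable_phi4HmcEnergy J lam (n := n)
  have hΨ := measurable_hmcProposal J lam δ N (Λ := Fin (n + 1))
  have hpair : Measurable fun p : Fin (n + 1) → ℝ => (φ, p) := measurable_const.prodMk measurable_id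
  have ha : Measurable fun p : Fin (n + 1) → ℝ =>
      involAccept (phi4HmcEnergy J lam) (hmcProposal J lam δ N) (φ, p) := by
    unfold involAccept
    exact measurable_const.min (Real.measurable_exp.comp
      ((hH.comp hpair).sub (hH.comp (hΨ.comp hpair))))
  refine Integrable.mono' integrable_momentumWeight
    (ha.mul measurable_momentumWeight).aestronglyMeasurable (Eventually.of_forall fun p => ?_)
  have hw0 : 0 ≤ momentumWeight p := (Real.exp_pos _).le
  rw [Real.norm_eq_abs, abs_mul, abs_of_nonneg (involAccept_nonneg _ _ _), abs_of_nonneg hw0]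
  exact mul_le_of_le_one_left hw0 (involAccept_le_one _ _ _)

/-- `∫ p_x² e^{−½Σp²} dp = Z_p` (`⟨p_x²⟩ = 1`, `HMCMomentumMoments.momentum_sq`). -/
theorem integral_sq_mul_momentumWeight (x : Fin (n + 1)) :
    ∫ p : Fin (n + 1) → ℝ, p x ^ 2 * momentumWeight p = momentumZ n := by
  have hZ : 0 < gibbsZ (halfDiag n) 0 := gibbsZ_pos_of_coercive (by norm_num) momentum_coercive
  have h := momentum_sq (n := n) x
  unfold gibbsExpect at h
  rw [div_eq_iff hZ.ne', one_mul] at h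
  rw [momentumZ_eq_gibbsZ, ← h]
  exact integral_congr_ae (Eventually.of_forall fun p => by
    simp only [momentumWeight_eq_gibbsWeight])

/-- `p ↦ p_x² e^{−½Σp²}` is integrable. -/
theorem integrable_sq_mul_momentumWeight (x : Fin (n + 1)) :
    Integrable (fun p : Fin (n + 1) → ℝ => p x ^ 2 * momentumWeight p) := by
  have h := integrable_momentum_pow_mul_pow (n := n) x x 2 0
  refine h.congr (Eventually.of_forall fun p => ?_)
  show p x ^ 2 * p x ^ 0 * gibbsWeight (halfDiag n) 0 p = p x ^ 2 * momentumWeight p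
  rw [pow_zero, mul_one, momentumWeight_eq_gibbsWeight]

/-- **Averaged acceptance bound**: under the hypotheses of `involAccept_le_of_mem_box`,
`Z_p⁻¹ ∫ a(φ, p) e^{−½Σp²} dp ≤ e^{−L} + V (δ/t)²`. -/
theorem accept_le_of_mem_box {lam δ t L : ℝ} (hlam : 0 < lam) (hδ : 0 < δ) (ht : 0 < t)
    (J : Fin (n + 1) → Fin (n + 1) → ℝ) {φ : Fin (n + 1) → ℝ}
    (hφ : ∀ y, t ≤ φ y ∧ φ y ≤ 2 * t)
    (hbig : t / δ + 5 * δ * t * (∑ x, ∑ y, |J x y|) ≤ δ * lam * t ^ 3 / 4)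
    (hgap : L ≤ ((n : ℝ) + 1) * (δ * lam * t ^ 3 / 4) ^ 2 / 2
        - ((n : ℝ) + 1) * (((∑ x, ∑ y, |J x y|) + 1) ^ 2 / (4 * lam))
        - 4 * t ^ 2 * (∑ x, ∑ y, |J x y|) - 16 * lam * ((n : ℝ) + 1) * t ^ 4
        - ((n : ℝ) + 1) * (t / δ) ^ 2 / 2) :
    (∫ p, involAccept (phi4HmcEnergy J lam) (hmcProposal J lam δ 1) (φ, p) * momentumWeight p)
        / momentumZ n
      ≤ Real.exp (-L) + ((n : ℝ) + 1) * (δ / t) ^ 2 := by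
  have hZp := momentumZ_pos n
  rw [div_le_iff₀ hZp]
  have hpt := involAccept_le_of_mem_box hlam hδ ht J hφ hbig hgap
  have hI1 : Integrable (fun p : Fin (n + 1) → ℝ =>
      (Real.exp (-L) + (δ / t) ^ 2 * ∑ x, p x ^ 2) * momentumWeight p) := by
    have e : ∀ p : Fin (n + 1) → ℝ, (Real.exp (-L) + (δ / t) ^ 2 * ∑ x, p x ^ 2) * momentumWeight p
        = Real.exp (-L) * momentumWeight p + (δ / t) ^ 2 * ∑ x, p x ^ 2 * momentumWeight p := by
      intro p
      rw [add_mul, mul_assoc, Finset.sum_mul]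
    simp_rw [e]
    exact (integrable_momentumWeight.const_mul _).add
      ((integrable_finsetSum _ fun x _ => integrable_sq_mul_momentumWeight x).const_mul _)
  calc ∫ p, involAccept (phi4HmcEnergy J lam) (hmcProposal J lam δ 1) (φ, p) * momentumWeight p
      ≤ ∫ p : Fin (n + 1) → ℝ, (Real.exp (-L) + (δ / t) ^ 2 * ∑ x, p x ^ 2) * momentumWeight p := by
        refine integral_mono_of_nonneg (Eventually.of_forall fun p =>
          mul_nonneg (involAccept_nonneg _ _ _) (Real.exp_pos _).le) hI1
          (Eventually.of_forall fun p => ?_)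
        exact mul_le_mul_of_nonneg_right (hpt p) (Real.exp_pos _).le
    _ = Real.exp (-L) * momentumZ n + (δ / t) ^ 2 * (((n : ℝ) + 1) * momentumZ n) := by
        have e : ∀ p : Fin (n + 1) → ℝ, (Real.exp (-L) + (δ / t) ^ 2 * ∑ x, p x ^ 2) * momentumWeight p
            = Real.exp (-L) * momentumWeight p + (δ / t) ^ 2 * ∑ x, p x ^ 2 * momentumWeight p := by
          intro p
          rw [add_mul, mul_assoc, Finset.sum_mul]
        simp_rw [e]
        rw [integral_add (integrable_momentumWeight.const_mul _)
          ((integrable_finsetSum _ fun x _ => integrable_sq_mul_momentumWeight x).const_mul _),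
          integral_const_mul, integral_const_mul,
          integral_finsetSum _ fun x _ => integrable_sq_mul_momentumWeight x]
        simp_rw [integral_sq_mul_momentumWeight]
        rw [Finset.sum_const, Finset.card_univ, Fintype.card_fin, nsmul_eq_mul]
        unfold momentumZ
        push_cast
        ring
    _ = (Real.exp (-L) + ((n : ℝ) + 1) * (δ / t) ^ 2) * momentumZ n := by ring

/-! ## §4 Choosing `t`: every threshold is met far enough out -/

/-- Elementary: for `t ≥ 1` with `a t² ≥ b + c + d + L` (`c, d, L ≥ 0`):
`a t⁶ − b t⁴ − c t² − d ≥ L`. -/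
theorem poly_gap_ge {a b c d L t : ℝ} (hc : 0 ≤ c) (hd : 0 ≤ d)
    (hL : 0 ≤ L) (ht : 1 ≤ t) (hbig : b + c + d + L ≤ a * t ^ 2) :
    L ≤ a * t ^ 6 - b * t ^ 4 - c * t ^ 2 - d := by
  have ht2 : 1 ≤ t ^ 2 := by nlinarith
  have ht4 : 1 ≤ t ^ 4 := by nlinarith
  have ht24 : t ^ 2 ≤ t ^ 4 := by nlinarith
  -- `a t⁶ − b t⁴ − c t² − d ≥ t⁴ (a t² − b − c − d) ≥ t⁴ L ≥ L`
  have h1 : c * t ^ 2 ≤ c * t ^ 4 := mul_le_mul_of_nonneg_left ht24 hc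
  have h2 : d ≤ d * t ^ 4 := by nlinarith
  have h3 : t ^ 4 * L ≤ t ^ 4 * (a * t ^ 2 - b - c - d) :=
    mul_le_mul_of_nonneg_left (by linarith) (by positivity)
  have h4 : L ≤ t ^ 4 * L := by nlinarith
  nlinarith

/-- Threshold (1): `t ≥ 1` and `t² ≥ (1/δ + 5δ C_J)/(δλ/4)` give the largeness condition of the kick
lemma, `t/δ + 5δ t C_J ≤ δλt³/4`. -/
theorem kick_threshold {lam δ t C : ℝ} (hlam : 0 < lam) (hδ : 0 < δ) (ht : 1 ≤ t)
    (h : (1 / δ + 5 * δ * C) / (δ * lam / 4) ≤ t ^ 2) :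
    t / δ + 5 * δ * t * C ≤ δ * lam * t ^ 3 / 4 := by
  have ht0 : 0 < t := by linarith
  have h1 : 1 / δ + 5 * δ * C ≤ (δ * lam / 4) * t ^ 2 := by
    have := (div_le_iff₀ (by positivity : (0 : ℝ) < δ * lam / 4)).mp h
    linarith
  have h2 : t * (1 / δ + 5 * δ * C) ≤ t * ((δ * lam / 4) * t ^ 2) :=
    mul_le_mul_of_nonneg_left h1 ht0.le
  have e1 : t * (1 / δ + 5 * δ * C) = t / δ + 5 * δ * t * C := by ring
  have e2 : t * ((δ * lam / 4) * t ^ 2) = δ * lam * t ^ 3 / 4 := by ring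
  linarith

/-- Threshold (2): the energy gap of `hmc_energy_gap_of_mem_box` is `a t⁶ − b t⁴ − c t² − d` with
`a = V(δλ/4)²/2`, `b = 16λV`, `c = 4 C_J + V/(2δ²)`, `d = K₀`; so `t ≥ 1` and
`t² ≥ (b + c + d + L)/a` make it `≥ L` (`L ≥ 0`). -/
theorem gap_threshold {lam δ t C V L : ℝ} (hlam : 0 < lam) (hδ : 0 < δ) (hC : 0 ≤ C) (hV : 0 < V)
    (hL : 0 ≤ L) (ht : 1 ≤ t)
    (h : (16 * lam * V + (4 * C + V * (1 / δ) ^ 2 / 2) + V * ((C + 1) ^ 2 / (4 * lam)) + L)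
        / (V * (δ * lam / 4) ^ 2 / 2) ≤ t ^ 2) :
    L ≤ V * (δ * lam * t ^ 3 / 4) ^ 2 / 2 - V * ((C + 1) ^ 2 / (4 * lam))
        - 4 * t ^ 2 * C - 16 * lam * V * t ^ 4 - V * (t / δ) ^ 2 / 2 := by
  have ha0 : 0 < V * (δ * lam / 4) ^ 2 / 2 := by positivity
  have hbig : 16 * lam * V + (4 * C + V * (1 / δ) ^ 2 / 2) + V * ((C + 1) ^ 2 / (4 * lam)) + L
      ≤ V * (δ * lam / 4) ^ 2 / 2 * t ^ 2 := by
    have := (div_le_iff₀ ha0).mp h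
    linarith
  have hp := poly_gap_ge (by positivity) (by positivity) hL ht hbig
  have e : V * (δ * lam / 4) ^ 2 / 2 * t ^ 6 - 16 * lam * V * t ^ 4
        - (4 * C + V * (1 / δ) ^ 2 / 2) * t ^ 2 - V * ((C + 1) ^ 2 / (4 * lam))
      = V * (δ * lam * t ^ 3 / 4) ^ 2 / 2 - V * ((C + 1) ^ 2 / (4 * lam))
        - 4 * t ^ 2 * C - 16 * lam * V * t ^ 4 - V * (t / δ) ^ 2 / 2 := by
    ring
  linarith

/-- Threshold (3): `t² ≥ 2Vδ²/ε` (`t, ε > 0`) makes the Chebyshev remainder `V(δ/t)² ≤ ε/2`. -/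
theorem cheb_threshold {δ t V ε : ℝ} (ht : 0 < t) (hε : 0 < ε)
    (h : 2 * V * δ ^ 2 / ε ≤ t ^ 2) : V * (δ / t) ^ 2 ≤ ε / 2 := by
  rw [div_le_iff₀ hε] at h
  have ht2 : 0 < t ^ 2 := by positivity
  rw [div_pow, ← mul_div_assoc, div_le_iff₀ ht2]
  nlinarith

/-- Threshold (4): with `L = max(0, log(2/ε))`, `e^{−L} ≤ ε/2` (`ε > 0`). -/
theorem exp_neg_threshold {ε : ℝ} (hε : 0 < ε) : Real.exp (-max 0 (Real.log (2 / ε))) ≤ ε / 2 := by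
  have h1 : Real.log (2 / ε) ≤ max 0 (Real.log (2 / ε)) := le_max_right _ _
  have h3 : Real.exp (-Real.log (2 / ε)) = ε / 2 := by
    rw [Real.exp_neg, Real.exp_log (by positivity), inv_div]
  rw [← h3]
  exact Real.exp_le_exp.mpr (by linarith)

/-- **FROM THE FAR BOX, ONE-STEP HMC IS REJECTED.**  Every `λ > 0`, real `J`, step size `δ > 0`:
for every `ε > 0` and every `T₀` there is `t ≥ max(T₀, 1)` such that from EVERY configuration `φ`
with `t ≤ φ_x ≤ 2t` for all `x`, the one-step HMC update (`hmcProposal J λ δ 1`: refresh, one qpq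
leapfrog step of size `δ`, flip, Metropolis test) is accepted with probability at most `ε`:
`Z_p⁻¹ ∫ a(φ, p) e^{−½Σp²} dp ≤ ε`. -/
theorem hmcPhi4_oneStep_accept_le_of_mem_box {lam δ : ℝ} (hlam : 0 < lam) (hδ : 0 < δ)
    (J : Fin (n + 1) → Fin (n + 1) → ℝ) {ε : ℝ} (hε : 0 < ε) (T₀ : ℝ) :
    ∃ t : ℝ, T₀ ≤ t ∧ 1 ≤ t ∧ ∀ φ : Fin (n + 1) → ℝ, (∀ y, t ≤ φ y ∧ φ y ≤ 2 * t) →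
      (∫ p, involAccept (phi4HmcEnergy J lam) (hmcProposal J lam δ 1) (φ, p) * momentumWeight p)
          / momentumZ n ≤ ε := by
  have hCJ0 : 0 ≤ ∑ x, ∑ y, |J x y| :=
    Finset.sum_nonneg fun x _ => Finset.sum_nonneg fun y _ => abs_nonneg _
  have hV0 : (0 : ℝ) < (n : ℝ) + 1 := by positivity
  have hL0 : 0 ≤ max 0 (Real.log (2 / ε)) := le_max_left _ _
  -- the three thresholds on `t²`, all nonnegative
  obtain ⟨C1, hC1, hC10⟩ : ∃ C1 : ℝ, C1 = (16 * lam * ((n : ℝ) + 1)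
      + (4 * (∑ x, ∑ y, |J x y|) + ((n : ℝ) + 1) * (1 / δ) ^ 2 / 2)
      + ((n : ℝ) + 1) * (((∑ x, ∑ y, |J x y|) + 1) ^ 2 / (4 * lam)) + max 0 (Real.log (2 / ε)))
        / (((n : ℝ) + 1) * (δ * lam / 4) ^ 2 / 2) ∧ 0 ≤ C1 := ⟨_, rfl, by positivity⟩
  obtain ⟨C2, hC2, hC20⟩ : ∃ C2 : ℝ,
      C2 = (1 / δ + 5 * δ * (∑ x, ∑ y, |J x y|)) / (δ * lam / 4) ∧ 0 ≤ C2 := ⟨_, rfl, by positivity⟩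
  obtain ⟨C3, hC3, hC30⟩ : ∃ C3 : ℝ, C3 = 2 * ((n : ℝ) + 1) * δ ^ 2 / ε ∧ 0 ≤ C3 :=
    ⟨_, rfl, by positivity⟩
  refine ⟨max T₀ 1 + C1 + C2 + C3, ?_, ?_, fun φ hφ => ?_⟩
  · linarith [le_max_left T₀ 1]
  · linarith [le_max_right T₀ 1]
  · have hm1 := le_max_right T₀ 1
    have ht1 : 1 ≤ max T₀ 1 + C1 + C2 + C3 := by linarith
    have ht0 : 0 < max T₀ 1 + C1 + C2 + C3 := by linarith
    have htsq : max T₀ 1 + C1 + C2 + C3 ≤ (max T₀ 1 + C1 + C2 + C3) ^ 2 := by nlinarith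
    have hbig := kick_threshold (C := ∑ x, ∑ y, |J x y|) hlam hδ ht1 (by rw [← hC2]; linarith)
    have hgap := gap_threshold (L := max 0 (Real.log (2 / ε))) hlam hδ hCJ0 hV0 hL0 ht1
      (by rw [← hC1]; linarith)
    have hcheb := cheb_threshold (δ := δ) (V := (n : ℝ) + 1) ht0 hε (by rw [← hC3]; linarith)
    have hacc := accept_le_of_mem_box hlam hδ ht0 J hφ hbig hgap
    have hexp := exp_neg_threshold hε
    linarith

/-! ## §5 The far box as an event: measurable, positive and small Gibbs mass -/

/-- The box `{t ≤ φ_x ≤ 2t ∀x}` is the order interval `[t·𝟙, 2t·𝟙]` of `ℝ^Λ`. -/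
theorem box_eq_Icc (t : ℝ) :
    {φ : Fin (n + 1) → ℝ | ∀ x, t ≤ φ x ∧ φ x ≤ 2 * t}
      = Set.Icc (fun _ => t) (fun _ => 2 * t) := by
  ext φ
  simp only [Set.mem_setOf_eq, Set.mem_Icc, Pi.le_def]
  exact ⟨fun h => ⟨fun x => (h x).1, fun x => (h x).2⟩, fun h x => ⟨h.1 x, h.2 x⟩⟩

/-- The box is measurable. -/
theorem measurableSet_box (t : ℝ) :
    MeasurableSet {φ : Fin (n + 1) → ℝ | ∀ x, t ≤ φ x ∧ φ x ≤ 2 * t} := by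
  rw [box_eq_Icc]
  exact measurableSet_Icc

/-- The box indicator is a bounded measurable observable. -/
theorem boxInd_bddObs (t : ℝ) :
    BddObs (fun φ : Fin (n + 1) → ℝ => if (∀ x, t ≤ φ x ∧ φ x ≤ 2 * t) then (1 : ℝ) else 0) := by
  refine ⟨Measurable.ite (measurableSet_box t) measurable_const measurable_const, 1, fun φ => ?_⟩
  show |(if (∀ x, t ≤ φ x ∧ φ x ≤ 2 * t) then (1 : ℝ) else 0)| ≤ 1
  split_ifs <;> norm_num

/-- **The box has positive Gibbs mass** (`t > 0`): `∫ χ_t e^{−S} > 0`. -/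
theorem integral_boxInd_pos {lam : ℝ} (hlam : 0 < lam) (J : Fin (n + 1) → Fin (n + 1) → ℝ)
    {t : ℝ} (ht : 0 < t) :
    0 < ∫ φ : Fin (n + 1) → ℝ, (if (∀ x, t ≤ φ x ∧ φ x ≤ 2 * t) then (1 : ℝ) else 0)
      * gibbsWeight J lam φ := by
  have hco := latticePhi4Action_coercive hlam J
  have hχ := boxInd_bddObs (n := n) t
  have hint : Integrable (fun φ : Fin (n + 1) → ℝ =>
      (if (∀ x, t ≤ φ x ∧ φ x ≤ 2 * t) then (1 : ℝ) else 0) * gibbsWeight J lam φ) := by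
    have h := bddObs_integrable_mul_mul_gibbsWeight one_pos hco hχ (bddObs_const 1)
    exact h.congr (Eventually.of_forall fun φ => by simp only [mul_one])
  have hnn : 0 ≤ᵐ[volume] fun φ : Fin (n + 1) → ℝ =>
      (if (∀ x, t ≤ φ x ∧ φ x ≤ 2 * t) then (1 : ℝ) else 0) * gibbsWeight J lam φ :=
    Eventually.of_forall fun φ => by
      have h0 := (gibbsWeight_pos J lam φ).le
      exact mul_nonneg (by split_ifs <;> norm_num) h0
  rw [integral_pos_iff_support_of_nonneg_ae hnn hint]
  -- the support contains the box, an order interval of positive Lebesgue measure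
  have hsub : Set.Icc (fun _ : Fin (n + 1) => t) (fun _ => 2 * t)
      ⊆ Function.support (fun φ : Fin (n + 1) → ℝ =>
        (if (∀ x, t ≤ φ x ∧ φ x ≤ 2 * t) then (1 : ℝ) else 0) * gibbsWeight J lam φ) := by
    intro φ hφ
    rw [← box_eq_Icc] at hφ
    have hφ' : ∀ x, t ≤ φ x ∧ φ x ≤ 2 * t := hφ
    rw [Function.mem_support, if_pos hφ', one_mul]
    exact (gibbsWeight_pos J lam φ).ne'
  refine lt_of_lt_of_le ?_ (measure_mono hsub)
  rw [Real.volume_Icc_pi]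
  refine pos_iff_ne_zero.mpr (Finset.prod_ne_zero_iff.mpr fun x _ => ?_)
  exact (ENNReal.ofReal_pos.mpr (by linarith)).ne'

/-- **Chebyshev**: `∫ χ_t e^{−S} ≤ t⁻² ∫ φ₀² e^{−S}` (`t > 0`): the box has small Gibbs mass. -/
theorem integral_boxInd_le {lam : ℝ} (hlam : 0 < lam) (J : Fin (n + 1) → Fin (n + 1) → ℝ)
    {t : ℝ} (ht : 0 < t) :
    ∫ φ : Fin (n + 1) → ℝ, (if (∀ x, t ≤ φ x ∧ φ x ≤ 2 * t) then (1 : ℝ) else 0) * gibbsWeight J lam φ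
      ≤ (1 / t ^ 2) * ∫ φ : Fin (n + 1) → ℝ, φ 0 ^ 2 * gibbsWeight J lam φ := by
  have hco := latticePhi4Action_coercive hlam J
  have hsq : Integrable (fun φ : Fin (n + 1) → ℝ => φ 0 ^ 2 * gibbsWeight J lam φ) := by
    have h := integrable_pow_mul_pow_mul_gibbsWeight_of_coercive one_pos hco (0 : Fin (n + 1)) 0 2 0
    exact h.congr (Eventually.of_forall fun φ => by simp only [pow_zero, mul_one])
  rw [← integral_const_mul]
  refine integral_mono_of_nonneg (Eventually.of_forall fun φ => ?_) (hsq.const_mul _)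
    (Eventually.of_forall fun φ => ?_)
  · have h0 := (gibbsWeight_pos J lam φ).le
    exact mul_nonneg (by split_ifs <;> norm_num) h0
  · have hw := (gibbsWeight_pos J lam φ).le
    show (if (∀ x, t ≤ φ x ∧ φ x ≤ 2 * t) then (1 : ℝ) else 0) * gibbsWeight J lam φ
      ≤ 1 / t ^ 2 * (φ 0 ^ 2 * gibbsWeight J lam φ)
    by_cases hφ : ∀ x, t ≤ φ x ∧ φ x ≤ 2 * t
    · rw [if_pos hφ, one_mul, ← mul_assoc]
      have h1 : 1 ≤ 1 / t ^ 2 * φ 0 ^ 2 := by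
        rw [one_div, ← div_eq_inv_mul, le_div_iff₀ (by positivity), one_mul]
        exact pow_le_pow_left₀ ht.le (hφ 0).1 2
      nlinarith
    · rw [if_neg hφ, zero_mul]
      positivity

end TailRejection

end Summit.Ventures.LatticeQCDFlow.Exactness
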